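import Mathlib.Data.Real.Basic
import Mathlib.Algebra.Order.AbsoluteValue.Basic
import Mathlib.Tactic
import HarnessLib

/-!
# Reading a peak off a sampled series: the lattice argmax, the three-point parabolic vertex, and how far apart they can be

Cell `pub-fluidc` (FLUID COMPUTER; host summit `NavierStokesRegularity`, negation side, machine paradigm), prover
seat p1 (gen 13, 2026-08-26). HONEST FRAMING: low prior, high value-of-information experiment on Tao's machine
paradigm; NOT a claim that NS blows up. Nothing in this file is about the Navier–Stokes equations. It types the
elementary arithmetic behind a pair of sentences the cell prints on every certified row and that its readers implement
in three conventions side by side (HOME/STATUS l.5055 / l.5204 / l.5206; p2's `r3nu_read` LATTICE object on the `0.05`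
output cadence, p2's FINEST re-read of every band row, and the '3-point parabolic' / 'quadratic vertex' companions:
"t_pk1,U = 1.400 (3-point parabolic 1.4042)", "g_pk 1.64941 (parabolic 1.64949)", "vertices 1.3998 / 2.5623"):

* the PARABOLA through three equally spaced samples `(t₀ − h, y₋)`, `(t₀, y₀)`, `(t₀ + h, y₊)` (`parab`, `parab_interpolates`),
  its VERTEX OFFSET `s* = h (y₋ − y₊) / (2 (y₋ − 2y₀ + y₊))` and VERTEX VALUE `y₀ − (y₊ − y₋)² / (8 (y₋ − 2y₀ + y₊))`
  (`vertexOffset`, `vertexValue`, `parab_vertexOffset`, the completed square `parab_eq_vertex_form`, and `parab_le_vertexValue`: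
  at a discrete peak the parabola opens downward and the vertex value is its maximum);
* the HALF-CELL LEMMA `abs_vertexOffset_le`: if the middle sample is a discrete peak (`y₋ ≤ y₀`, `y₊ ≤ y₀`, not all three equal)
  the parabolic instant lies within `h/2` of the lattice instant — with equality exactly on a one-sided flat top
  (`vertexOffset_of_flat_right` / `_left`), and offset `0` on a symmetric triple (`vertexOffset_of_symm`); the sign of the offset
  follows the higher neighbour (`vertexOffset_pos_iff`);
* the VALUE LEMMA `vertexValue_sub_le`: the parabolic peak value exceeds the lattice peak value by
  `(d₋ − d₊)²/(8 (d₋ + d₊)) ≤ max(d₋, d₊)/8` where `d∓ = y₀ − y∓` are the one-sided drops; in relative form, drops `≤ δ·y₀` give a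
  parabolic value within `δ/8` of the lattice value (`vertexValue_rel_le`) — which is why `g_pk` agrees to `0.005 %` between the
  conventions on a top flat to `0.13 %` while the INSTANT can move by half a cell;
* near-maxima on a flat top (`IsNearMax`, `isNearMax_of_flat`): on a top flat to `ε` every sample of the top is an `ε`-argmax, so
  two argmax conventions may legitimately disagree by the width of the flat top; a companion series read 'at the peak' then moves
  by its own slope times that width (`companion_spread_le`) — the OWN-PEAK vs MATCHED-INSTANT split of a cross-leg difference
  is `LevelTwoReascent.own_peak_decomposition` (module `LevelTwoReascent384`), not repeated here;
* INSTANCES from the record (numbers only, HOME/STATUS l.5204): the 384³ `U_out` lattice triple `2.6048 / 2.6083 / 2.6048` at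
  `1.35 / 1.40 / 1.45` is symmetric ⇒ parabolic instant `= 1.400` exactly, value `2.6083` (`record384_Uout_triple`); the printed
  `g_pk` pair `1.64941` (lattice) / `1.64949` (parabolic) differs by `0.005 % ≤ 0.13 %/8` (`record384_gpk_conventions`); the 256³
  lattice/finest instants `1.400 / 1.418` differ by `0.018 ≤ h/2 = 0.025` (`record256_instants_half_cell`); and with the companion
  `G = u_max/u_max(0)` falling `4.5 %` per `0.10` around the peak (`1.5979 → 1.5252` on 256³), a half-cell move of the instant is
  worth up to `≈ 1.1 %` of `G` — the size of the `+1.18 %` INSTANT part on the record (`half_cell_worth_in_G`).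
Design choice: plain real arithmetic on three named samples (no `Finset` argmax machinery); every hypothesis is the discrete-peak
condition the readers check before they print a peak ('interior', 'peaked'). Standard material (three-point / successive parabolic
interpolation of an extremum); no source is followed, nothing is cited as a result. 0 sorry; no named fact.
-/

noncomputable section

namespace Summit.NavierStokesRegularity.FluidComputer.PeakReadout

/-! ### The parabola through three equally spaced samples -/

/-- The interpolating parabola through `(−h, y₋)`, `(0, y₀)`, `(h, y₊)` as a function of the offset `s` from the middle
instant: `y₀ + (y₊ − y₋)/(2h) · s + (y₋ − 2y₀ + y₊)/(2h²) · s²`. -/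
def parab (ym y0 yp h s : ℝ) : ℝ :=
  y0 + (yp - ym) / (2 * h) * s + (ym - 2 * y0 + yp) / (2 * h ^ 2) * s ^ 2

/-- The VERTEX OFFSET of that parabola: `s* = h (y₋ − y₊) / (2 (y₋ − 2y₀ + y₊))` (junk value `0` when the three samples are
collinear, `y₋ − 2y₀ + y₊ = 0`, by `x / 0 = 0`; every theorem below that needs a vertex assumes a discrete peak). -/
def vertexOffset (ym y0 yp h : ℝ) : ℝ := h * (ym - yp) / (2 * (ym - 2 * y0 + yp))

/-- The VERTEX VALUE: `y₀ − (y₊ − y₋)² / (8 (y₋ − 2y₀ + y₊))` (same junk convention; equals `y₀` on a collinear triple). -/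
def vertexValue (ym y0 yp : ℝ) : ℝ := y0 - (yp - ym) ^ 2 / (8 * (ym - 2 * y0 + yp))

/-- The parabola interpolates the three samples. -/
theorem parab_interpolates (ym y0 yp : ℝ) {h : ℝ} (hh : h ≠ 0) :
    parab ym y0 yp h (-h) = ym ∧ parab ym y0 yp h 0 = y0 ∧ parab ym y0 yp h h = yp := by
  unfold parab
  refine ⟨?_, by ring, ?_⟩ <;> field_simp <;> ring

/-- At the vertex offset the parabola takes the vertex value (discrete curvature `y₋ − 2y₀ + y₊ ≠ 0`). -/
theorem parab_vertexOffset (ym y0 yp : ℝ) {h : ℝ} (hh : h ≠ 0) (hc : ym - 2 * y0 + yp ≠ 0) :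
    parab ym y0 yp h (vertexOffset ym y0 yp h) = vertexValue ym y0 yp := by
  unfold parab vertexOffset vertexValue
  -- the identity holds with the curvature `c` as a free nonzero symbol
  generalize ym - 2 * y0 + yp = c at hc ⊢
  field_simp
  ring

/-- COMPLETED SQUARE: `parab(s) = vertexValue + (y₋ − 2y₀ + y₊)/(2h²) · (s − s*)²`. -/
theorem parab_eq_vertex_form (ym y0 yp : ℝ) {h : ℝ} (hh : h ≠ 0) (hc : ym - 2 * y0 + yp ≠ 0) (s : ℝ) :
    parab ym y0 yp h s =
      vertexValue ym y0 yp + (ym - 2 * y0 + yp) / (2 * h ^ 2) * (s - vertexOffset ym y0 yp h) ^ 2 := by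
  unfold parab vertexOffset vertexValue
  generalize ym - 2 * y0 + yp = c at hc ⊢
  field_simp
  ring

/-- At a DISCRETE PEAK (`y₋ − 2y₀ + y₊ < 0`: the parabola opens downward) the vertex value is the maximum of the parabola. -/
theorem parab_le_vertexValue (ym y0 yp : ℝ) {h : ℝ} (hh : h ≠ 0) (hc : ym - 2 * y0 + yp < 0) (s : ℝ) :
    parab ym y0 yp h s ≤ vertexValue ym y0 yp := by
  rw [parab_eq_vertex_form ym y0 yp hh hc.ne s]
  have h2 : 0 < 2 * h ^ 2 := by positivity
  have : (ym - 2 * y0 + yp) / (2 * h ^ 2) * (s - vertexOffset ym y0 yp h) ^ 2 ≤ 0 :=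
    mul_nonpos_of_nonpos_of_nonneg (div_nonpos_of_nonpos_of_nonneg hc.le h2.le) (sq_nonneg _)
  linarith

/-- A discrete peak that is not a flat collinear triple has negative discrete curvature: `y₋ ≤ y₀`, `y₊ ≤ y₀` and
`¬(y₋ = y₀ ∧ y₊ = y₀)` give `y₋ − 2y₀ + y₊ < 0`. -/
theorem secondDiff_neg_of_peak {ym y0 yp : ℝ} (hm : ym ≤ y0) (hp : yp ≤ y0) (hne : ¬ (ym = y0 ∧ yp = y0)) :
    ym - 2 * y0 + yp < 0 := by
  rcases lt_or_eq_of_le hm with h | h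
  · linarith
  · have : yp ≠ y0 := fun h' => hne ⟨h, h'⟩
    have : yp < y0 := lt_of_le_of_ne hp this
    linarith

/-! ### The half-cell lemma: where the parabolic instant can sit relative to the lattice instant -/

/-- In terms of the one-sided DROPS `d₋ = y₀ − y₋`, `d₊ = y₀ − y₊` (`y₋ − y₊ = d₊ − d₋`, `y₋ − 2y₀ + y₊ = −(d₋ + d₊)`):
`s* = h (d₋ − d₊) / (2 (d₋ + d₊))` — the vertex leans toward the SMALLER drop (the higher neighbour). -/
theorem vertexOffset_eq_drops (ym y0 yp h : ℝ) :
    vertexOffset ym y0 yp h = h * ((y0 - ym) - (y0 - yp)) / (2 * ((y0 - ym) + (y0 - yp))) := by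
  unfold vertexOffset
  by_cases hc : ym - 2 * y0 + yp = 0
  · have hc' : (y0 - ym) + (y0 - yp) = 0 := by linarith
    rw [hc, hc']; simp
  · have hc' : (y0 - ym) + (y0 - yp) ≠ 0 := fun h' => hc (by linarith)
    rw [div_eq_div_iff (mul_ne_zero two_ne_zero hc) (mul_ne_zero two_ne_zero hc')]
    ring

/-- THE HALF-CELL LEMMA: at a discrete peak (`y₋ ≤ y₀`, `y₊ ≤ y₀`, not all equal) the parabolic instant is within half a cell of
the lattice instant, `|s*| ≤ h/2` (for `|d₋ − d₊| ≤ d₋ + d₊`). -/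
theorem abs_vertexOffset_le {ym y0 yp h : ℝ} (hh : 0 ≤ h) (hm : ym ≤ y0) (hp : yp ≤ y0)
    (hne : ¬ (ym = y0 ∧ yp = y0)) : |vertexOffset ym y0 yp h| ≤ h / 2 := by
  have hc := secondDiff_neg_of_peak hm hp hne
  have hS : 0 < (y0 - ym) + (y0 - yp) := by linarith
  rw [vertexOffset_eq_drops, abs_div, abs_mul, abs_of_nonneg hh,
    abs_of_pos (by linarith : (0 : ℝ) < 2 * ((y0 - ym) + (y0 - yp))), div_le_iff₀ (by linarith)]
  have hnum : |(y0 - ym) - (y0 - yp)| ≤ (y0 - ym) + (y0 - yp) := by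
    rw [abs_le]; constructor <;> linarith
  nlinarith

/-- SYMMETRIC TRIPLE (`y₋ = y₊`): the parabolic instant IS the lattice instant and the parabolic value IS the lattice value. -/
theorem vertexOffset_of_symm {ym y0 yp : ℝ} (h : ℝ) (hs : ym = yp) :
    vertexOffset ym y0 yp h = 0 ∧ vertexValue ym y0 yp = y0 := by
  subst hs; unfold vertexOffset vertexValue; simp

/-- ONE-SIDED FLAT TOP to the right (`y₊ = y₀ > y₋`): the offset is EXACTLY `+h/2` — the half-cell bound is attained. -/
theorem vertexOffset_of_flat_right {ym y0 yp : ℝ} (h : ℝ) (hflat : yp = y0) (hdrop : ym < y0) :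
    vertexOffset ym y0 yp h = h / 2 := by
  subst hflat
  unfold vertexOffset
  have hden : 2 * (ym - 2 * yp + yp) ≠ 0 := by
    have : ym - 2 * yp + yp = -(yp - ym) := by ring
    rw [this]; intro h0; linarith
  rw [div_eq_iff hden]
  ring

/-- ONE-SIDED FLAT TOP to the left (`y₋ = y₀ > y₊`): the offset is EXACTLY `−h/2`. -/
theorem vertexOffset_of_flat_left {ym y0 yp : ℝ} (h : ℝ) (hflat : ym = y0) (hdrop : yp < y0) :
    vertexOffset ym y0 yp h = -(h / 2) := by
  subst hflat
  unfold vertexOffset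
  have hden : 2 * (ym - 2 * ym + yp) ≠ 0 := by
    have : ym - 2 * ym + yp = -(ym - yp) := by ring
    rw [this]; intro h0; linarith
  rw [div_eq_iff hden]
  ring

/-- The SIGN of the offset follows the higher neighbour: at a discrete peak with `h > 0`, `s* > 0 ↔ y₊ > y₋`. -/
theorem vertexOffset_pos_iff {ym y0 yp h : ℝ} (hh : 0 < h) (hm : ym ≤ y0) (hp : yp ≤ y0)
    (hne : ¬ (ym = y0 ∧ yp = y0)) : 0 < vertexOffset ym y0 yp h ↔ ym < yp := by
  have hc := secondDiff_neg_of_peak hm hp hne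
  have hden : 2 * (ym - 2 * y0 + yp) < 0 := by linarith
  unfold vertexOffset
  constructor
  · intro hpos
    rcases div_pos_iff.mp hpos with ⟨_, h2⟩ | ⟨h1, _⟩
    · linarith
    · have : ym - yp < 0 := by
        rcases lt_or_ge (ym - yp) 0 with hlt | hge
        · exact hlt
        · exact absurd h1 (not_lt.mpr (mul_nonneg hh.le hge))
      linarith
  · intro hlt
    exact div_pos_iff.mpr (Or.inr ⟨mul_neg_of_pos_of_neg hh (by linarith), hden⟩)

/-! ### The value lemma: the parabolic peak value vs the lattice peak value -/

/-- In terms of the drops: `vertexValue − y₀ = (d₋ − d₊)² / (8 (d₋ + d₊))`. -/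
theorem vertexValue_sub_eq_drops (ym y0 yp : ℝ) :
    vertexValue ym y0 yp - y0 = ((y0 - ym) - (y0 - yp)) ^ 2 / (8 * ((y0 - ym) + (y0 - yp))) := by
  unfold vertexValue
  have e1 : ym - 2 * y0 + yp = -((y0 - ym) + (y0 - yp)) := by ring
  have e2 : (yp - ym) ^ 2 = ((y0 - ym) - (y0 - yp)) ^ 2 := by ring
  rw [e1, e2, mul_neg, div_neg]
  ring

/-- THE VALUE LEMMA: at a discrete peak the parabolic value is AT LEAST the lattice value and exceeds it by at most one eighth of the
larger one-sided drop: `0 ≤ vertexValue − y₀ ≤ max(d₋, d₊)/8`. -/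
theorem vertexValue_sub_le {ym y0 yp : ℝ} (hm : ym ≤ y0) (hp : yp ≤ y0) (hne : ¬ (ym = y0 ∧ yp = y0)) :
    0 ≤ vertexValue ym y0 yp - y0 ∧ vertexValue ym y0 yp - y0 ≤ max (y0 - ym) (y0 - yp) / 8 := by
  have hc := secondDiff_neg_of_peak hm hp hne
  set a := y0 - ym with ha
  set b := y0 - yp with hb
  have ha0 : 0 ≤ a := by linarith
  have hb0 : 0 ≤ b := by linarith
  have hS : 0 < a + b := by linarith
  rw [vertexValue_sub_eq_drops, ← ha, ← hb]
  refine ⟨by positivity, ?_⟩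
  rw [div_le_div_iff₀ (by linarith) (by norm_num)]
  -- `(a − b)² · 8 ≤ max(a,b) · (8 (a + b))`, from `(a − b)² ≤ max(a,b)² ≤ max(a,b) (a + b)`
  have hM : |a - b| ≤ max a b := by
    rw [abs_le]; constructor
    · linarith [le_max_right a b]
    · linarith [le_max_left a b]
  have hM0 : 0 ≤ max a b := le_max_of_le_left ha0
  have h1 : (a - b) ^ 2 ≤ (max a b) ^ 2 := by
    calc (a - b) ^ 2 = |a - b| ^ 2 := (sq_abs _).symm
      _ ≤ (max a b) ^ 2 := pow_le_pow_left₀ (abs_nonneg _) hM 2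
  have h2 : (max a b) ^ 2 ≤ max a b * (a + b) := by
    rw [sq]; exact mul_le_mul_of_nonneg_left (max_le (by linarith) (by linarith)) hM0
  nlinarith

/-- RELATIVE FORM: one-sided drops of at most `δ · y₀` (a top flat to `δ`) put the parabolic value within `δ/8 · y₀` of the lattice
value — the peak VALUE is insensitive to the convention at second order in the flatness, while the INSTANT may move by `h/2`. -/
theorem vertexValue_rel_le {ym y0 yp δ : ℝ} (hm : ym ≤ y0) (hp : yp ≤ y0) (hne : ¬ (ym = y0 ∧ yp = y0))
    (hdm : y0 - ym ≤ δ * y0) (hdp : y0 - yp ≤ δ * y0) :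
    |vertexValue ym y0 yp - y0| ≤ δ / 8 * y0 := by
  obtain ⟨h0, h1⟩ := vertexValue_sub_le hm hp hne
  rw [abs_of_nonneg h0]
  have : max (y0 - ym) (y0 - yp) ≤ δ * y0 := max_le hdm hdp
  linarith

/-! ### Flat tops: near-maxima and the companion spread -/

/-- `t` is an `ε`-ARGMAX of the series `U` over the index set `S`: no sample in `S` exceeds `U t` by more than `ε`. -/
def IsNearMax (U : ℝ → ℝ) (S : Set ℝ) (ε t : ℝ) : Prop := ∀ s ∈ S, U s ≤ U t + ε

/-- An exact argmax is a `0`-argmax (and an `ε`-argmax for every `ε ≥ 0`). -/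
theorem isNearMax_of_isMax {U : ℝ → ℝ} {S : Set ℝ} {t ε : ℝ} (hε : 0 ≤ ε) (hmax : ∀ s ∈ S, U s ≤ U t) :
    IsNearMax U S ε t := fun s hs => (hmax s hs).trans (by linarith)

/-- FLAT TOP: if `t₁` is an exact argmax and `U t₂` is within `ε` of `U t₁`, then `t₂` is an `ε`-argmax too — on a top flat to `ε`
every sample of the top is a legitimate peak instant at tolerance `ε`, so two argmax conventions (cadences) may disagree by the
width of the flat top without either being wrong. -/
theorem isNearMax_of_flat {U : ℝ → ℝ} {S : Set ℝ} {t₁ t₂ ε : ℝ} (hmax : ∀ s ∈ S, U s ≤ U t₁)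
    (hflat : U t₁ - U t₂ ≤ ε) : IsNearMax U S ε t₂ := fun s hs => by linarith [hmax s hs]

/-- Monotonicity in the tolerance. -/
theorem IsNearMax.mono {U : ℝ → ℝ} {S : Set ℝ} {t ε ε' : ℝ} (h : IsNearMax U S ε t) (hε : ε ≤ ε') :
    IsNearMax U S ε' t := fun s hs => (h s hs).trans (by linarith)

/-- COMPANION SPREAD: a companion series `G` that moves by at most `L` per unit time reads, at two admissible peak instants at most
`w` apart, values at most `L · w` apart — the 'instant part' of an own-peak comparison is the companion's slope times the ambiguity
of the instant, however flat the peak of `U` itself is. -/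
theorem companion_spread_le {G : ℝ → ℝ} {t₁ t₂ L w : ℝ} (hL : 0 ≤ L) (hG : |G t₁ - G t₂| ≤ L * |t₁ - t₂|)
    (hw : |t₁ - t₂| ≤ w) : |G t₁ - G t₂| ≤ L * w :=
  hG.trans (mul_le_mul_of_nonneg_left hw hL)

/-! ### Instances from the record (HOME/STATUS l.5204 / l.5206; numbers only — every word on them is the LEAD's) -/

/-- The 384³ engine-of-record leg of u0_b⁽²⁾ (kit j247830): the `U_out` LATTICE TRIPLE at `t = 1.35 / 1.40 / 1.45` is
`2.6048 / 2.6083 / 2.6048` — SYMMETRIC, so the three-point parabolic instant is EXACTLY the lattice instant `1.400` and the parabolic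
value is the lattice value `2.6083` (p2's printed '3-point parabolic 1.4042' is taken on the finer diag cadence, not on this triple);
the triple is a discrete peak with drops `0.0035` each, a top flat to `0.135 %`. -/
theorem record384_Uout_triple :
    vertexOffset 2.6048 2.6083 2.6048 0.05 = 0 ∧ vertexValue 2.6048 2.6083 2.6048 = 2.6083 ∧
    (1.400 : ℝ) + vertexOffset 2.6048 2.6083 2.6048 0.05 = 1.400 ∧
    (2.6083 : ℝ) - 2.6048 = 0.0035 ∧ (0.0035 : ℝ) ≤ 0.00135 * 2.6083 := by
  refine ⟨(vertexOffset_of_symm 0.05 rfl).1, (vertexOffset_of_symm (0.05 : ℝ) rfl).2, ?_, by norm_num, by norm_num⟩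
  rw [(vertexOffset_of_symm 0.05 rfl).1]; norm_num

/-- The printed `g_pk` pair of that leg, LATTICE `1.64941` vs PARABOLIC `1.64949`: a relative difference of `≤ 0.005 %`, inside the
value lemma's `δ/8 = 0.135 %/8 ≈ 0.017 %` for a top flat to `0.135 %` — the peak VALUE is convention-insensitive to second order. -/
theorem record384_gpk_conventions :
    |(1.64949 : ℝ) - 1.64941| ≤ 0.00005 * 1.64941 ∧ (0.00005 : ℝ) ≤ 0.00135 / 8 := by
  norm_num [abs_le]

/-- The 256³ engine-of-record leg (kit j246650): LATTICE instant `1.400` vs FINEST instant `1.418` — a move of `0.018`, inside half a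
lattice cell `h/2 = 0.025` (the half-cell lemma's bound for the parabolic instant; the finest argmax obeys it on this row as a fact of
the record, not as a theorem about every series). At 384³ the two instants coincide (`1.400 / 1.400`). -/
theorem record256_instants_half_cell :
    |(1.418 : ℝ) - 1.400| ≤ 0.05 / 2 ∧ |(1.400 : ℝ) - 1.400| ≤ 0.05 / 2 ∧ ¬ |(1.418 : ℝ) - 1.400| ≤ 0.05 / 3 := by
  norm_num [abs_le]

/-- WHAT A HALF CELL IS WORTH IN THE COMPANION `G = u_max/u_max(0)`: on the 256³ leg `G(1.35) = 1.5979` and `G(1.45) = 1.5252`, a fall of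
`4.5 %` of `G(1.35)` per `0.10`, i.e. a slope `L = 0.727` per unit time; by `companion_spread_le` a half-cell (`0.025`) ambiguity of the
peak instant is worth `≤ 0.0182` in `G`, `≈ 1.14 %` of `1.5979` — the size of the `+1.18 %` INSTANT part of the record's `+1.00 %`
finest-convention `ΔG(t_pk1,U)` (`LevelTwoReascent.grid256_384_G_decomposition`), against a GRID part of `−0.18 %`. -/
theorem half_cell_worth_in_G :
    ((1.5979 : ℝ) - 1.5252) / 0.10 = 0.727 ∧ (0.045 : ℝ) * 1.5979 ≤ 1.5979 - 1.5252 ∧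
    (0.727 : ℝ) * (0.05 / 2) ≤ 0.0182 ∧ (0.0182 : ℝ) ≤ 0.0114 * 1.5979 ∧
    (∀ G : ℝ → ℝ, ∀ t₁ t₂ : ℝ, |G t₁ - G t₂| ≤ 0.727 * |t₁ - t₂| → |t₁ - t₂| ≤ 0.05 / 2 → |G t₁ - G t₂| ≤ 0.727 * (0.05 / 2)) := by
  refine ⟨by norm_num, by norm_num, by norm_num, by norm_num, fun G t₁ t₂ hG hw => companion_spread_le (by norm_num) hG hw⟩


/-! ### APPEND (p1 gen 13, after acceptance of the above): a CONCAVE top pins every finer argmax to within ONE cell of the lattice argmax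

The half-cell lemma above is about the parabolic estimator; the FINEST convention (argmax on a finer cadence that contains the lattice
instants) needs a hypothesis on the series itself. The natural one the readers' 'peaked / interior' checks presuppose is concavity of the
band-sup series on a neighbourhood of its top: then no sample anywhere outside the open lattice cell `(t₀ − h, t₀ + h)` can exceed the
lattice peak value, so every finer argmax that sees the lattice samples lies within ONE cell of the lattice instant (or ties it). Record:
`|1.418 − 1.400| = 0.018 < h = 0.05` on the 256³ leg (and `0` at 384³). Mathlib's `ConcaveOn.left_le_of_le_right''` /
`right_le_of_le_left''` (three-chord lemmas on an ordered field) do the work. -/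

/-- CONCAVE TOP ⇒ EXCEEDANCE ONLY INSIDE THE CELL: if `U` is concave on `s ∋ t₀` and the lattice triple is a discrete peak
(`U(t₀ ∓ h) ≤ U(t₀)`; membership of `t₀ ∓ h` in `s` is not even needed — only the two inequalities), then every `t ∈ s` with
`U t > U t₀` lies in the open cell `(t₀ − h, t₀ + h)`. -/
theorem exceed_only_within_cell {U : ℝ → ℝ} {s : Set ℝ} (hU : ConcaveOn ℝ s U) {t₀ h : ℝ} (hh : 0 < h)
    (h0 : t₀ ∈ s) (hdm : U (t₀ - h) ≤ U t₀) (hdp : U (t₀ + h) ≤ U t₀)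
    {t : ℝ} (ht : t ∈ s) (hgt : U t₀ < U t) : t₀ - h < t ∧ t < t₀ + h := by
  by_contra hnot
  rcases not_and_or.mp hnot with hle | hge
  · -- `t ≤ t₀ − h`: the chord through `t, t₀ − h, t₀` gives `U t ≤ U (t₀ − h) ≤ U t₀`
    have h1 : U t ≤ U (t₀ - h) := hU.left_le_of_le_right'' ht h0 (not_lt.mp hle) (by linarith) hdm
    linarith
  · -- `t ≥ t₀ + h`: the chord through `t₀, t₀ + h, t` gives `U t ≤ U (t₀ + h) ≤ U t₀`
    have h1 : U t ≤ U (t₀ + h) := hU.right_le_of_le_left'' h0 ht (by linarith) (not_lt.mp hge) hdp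
    linarith

/-- Hence a FINER ARGMAX that sees the lattice peak sample (`U t₀ ≤ U t_f`, as when the fine cadence contains the lattice instants) is within
ONE cell of the lattice instant, or ties the lattice value (a flat tie, which concavity does not exclude). -/
theorem finest_within_cell_or_tie {U : ℝ → ℝ} {s : Set ℝ} (hU : ConcaveOn ℝ s U) {t₀ h : ℝ} (hh : 0 < h)
    (h0 : t₀ ∈ s) (hdm : U (t₀ - h) ≤ U t₀) (hdp : U (t₀ + h) ≤ U t₀)
    {tf : ℝ} (htf : tf ∈ s) (hge : U t₀ ≤ U tf) : |tf - t₀| < h ∨ U tf = U t₀ := by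
  rcases hge.lt_or_eq with hlt | heq
  · left
    obtain ⟨h1, h2⟩ := exceed_only_within_cell hU hh h0 hdm hdp htf hlt
    rw [abs_sub_lt_iff]; constructor <;> linarith
  · right; exact heq.symm

/-- And an exact argmax of `U` over `s` can always be taken within the CLOSED cell `[t₀ − h, t₀ + h]`: either the given argmax is inside the open
cell, or it ties the lattice value and `t₀` itself is an argmax. -/
theorem argmax_within_cell {U : ℝ → ℝ} {s : Set ℝ} (hU : ConcaveOn ℝ s U) {t₀ h : ℝ} (hh : 0 < h)
    (h0 : t₀ ∈ s) (hdm : U (t₀ - h) ≤ U t₀) (hdp : U (t₀ + h) ≤ U t₀)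
    {tstar : ℝ} (hts : tstar ∈ s) (hstar : ∀ u ∈ s, U u ≤ U tstar) :
    ∃ t' ∈ s, |t' - t₀| ≤ h ∧ ∀ u ∈ s, U u ≤ U t' := by
  rcases (hstar t₀ h0).lt_or_eq with hlt | heq
  · obtain ⟨h1, h2⟩ := exceed_only_within_cell hU hh h0 hdm hdp hts hlt
    exact ⟨tstar, hts, by rw [abs_le]; constructor <;> linarith, hstar⟩
  · exact ⟨t₀, h0, by simp [hh.le], fun u hu => heq ▸ hstar u hu⟩

/-- Without a shape hypothesis nothing of the kind holds: a series can carry a discrete peak at `t₀` on the lattice and a higher value anywhere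
off the lattice. Witness on `s = univ`, `h = 1`, `t₀ = 0`: `U = ` the indicator of `{1/2} ∪ {5}` scaled — concretely `U t = if t = 5 then 1 else 0`
has the (flat) discrete peak `U(−1) = U 0 = U 1 = 0` and exceeds it at `t = 5`, four cells away. -/
theorem no_cell_bound_without_shape :
    ∃ U : ℝ → ℝ, U (0 - 1) ≤ U 0 ∧ U (0 + 1) ≤ U 0 ∧ U 0 < U 5 ∧ ¬ (0 - 1 < (5 : ℝ) ∧ (5 : ℝ) < 0 + 1) := by
  refine ⟨fun t => if t = 5 then 1 else 0, ?_, ?_, ?_, ?_⟩ <;> norm_num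

/-- RECORD (HOME/STATUS l.5055 / l.5204): on the 256³ engine-of-record leg the FINEST instant `1.418` is within ONE lattice cell (`h = 0.05`)
of the LATTICE instant `1.400` — indeed within `0.36 h` — and at 384³ the two coincide; both as the concave-top lemma requires of a finer
argmax that sees the lattice samples (the fine cadence 'every 6 steps + every 0.05' contains the lattice instants). -/
theorem record_finest_within_cell :
    |(1.418 : ℝ) - 1.400| < 0.05 ∧ |(1.418 : ℝ) - 1.400| ≤ 0.36 * 0.05 ∧ |(1.400 : ℝ) - 1.400| < 0.05 := by
  norm_num [abs_lt, abs_le]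

end Summit.NavierStokesRegularity.FluidComputer.PeakReadout

end
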